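import Summits.BirchSwinnertonDyer.BirchSwinnertonDyer.Theorems.EisensteinPrimesAnomalousLocalMover
import Literature.NumberTheory.EllipticCurves.IwasawaTowerTorsionOrdinaryProofs
import Literature.NumberTheory.EllipticCurves.GeomReductionFrobeniusProofs
import HarnessLib

/-!
# Route `EisensteinPrimes`, crux 2 `GoodLatticeBDPValue` (stmt-BirchSwinnertonDyer-19032), line `halves`, V20 road
# brick (f), part 4: Fin_v at a good ordinary ANOMALOUS prime — the `ℚ`-side core: the fixed part of `E[p^∞]` under
# a subgroup `N ≤ Γ_ℚ` that moves the rational line, is normalised by inertia and contains a Frobenius power up to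
# inertia, is FINITE (it embeds by reduction into the `φ^n`-fixed points of `Ẽ(𝔽̄_p)`)

Cell `bsd-eis` (home `run/shared/lean/pub/bsd-eis/`), width seat `bsd-line-x1-p1-w2` gen 3 (`--supports -19032`,
closes nothing). Keller–Yin Prop. 1.3.3 (iii) (arXiv:2402.12781v2 TeX L948–957): «`A[p^∞](K_{∞,w}) = H⁰(K_w, M_f)` is
finite» at the anomalous `w ∣ p`, by Néron models — «`G⁰(𝒪_{K_{n,w}}) = 0` … `G^{ét}(𝒪_{K_{n,w}}) ≅ G^{ét}(𝔽_n)` … will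
eventually stabilize … since an abelian variety has only finitely many points over a finite field». It is the input of KY
Lemma 1.3.6 (`ker(res_{M_f})` finite ⇒ `λ(𝔛_Gr) = λ(𝔛_nr)` for `f`), which the v20 road needs to pass between Castella's
STRICT dual `𝔛^{Sf}_f` (the crux's object) and KY's `nr` dual (STATUS l.3162 reading (R2)); in the tree it is the predicate
Fin_v = `SchneiderFreeControlAtoms.LocalTowerTorsionFiniteAt`, proved so far only off the anomalous case. This file is the
`ℚ`-side CORE of a Galois-module proof (no Néron models): for `E = W/ℚ` globally minimal, `p ∤ Δ` good ORDINARY (`p ∤ a_p`),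
the prime `𝔓₀` of `\bar ℤ` cut out by the place, the rational `p`-line `Φ₀` NOT unramified at `p`, and a subgroup
`N ≤ Γ_ℚ` such that (N1) some element of `N` moves `Φ₀`, (N2) the `N`-fixed part `B = E[p^∞]^N` is stable under
`I_{𝔓₀}`, (N3) `σⁿ τ ∈ N` for an arithmetic Frobenius `σ` at `𝔓₀`, some `n ≥ 1` and some `τ ∈ I_{𝔓₀}`:

* §1 `zp_saturate_of_isClosed`, **`exists_pow_mul_mem_kerSubgroup`** — for a `ℤ_p`-extension `κ` of a number field and a
  CLOSED subgroup `I ≤ Γ_K` with `κ(I) ≠ 1`: every `σ ∈ Γ_K` has `σ^{pᵐ} τ ∈ ker κ` for some `m` and `τ ∈ I` (`κ(I)` is a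
  closed non-zero subgroup of `ℤ_p`, hence `⊇ pᵐ ℤ_p`; used in part 5 with `I = I_v̄`, (N3));
* §2 **`finite_setOf_frob_pow_smul_eq`** — the `φⁿ`-fixed points of `Ẽ(𝔽̄_p)` (`φ` the `p`-power Frobenius, `n ≠ 0`)
  form a finite set (coordinates are roots of `X^{pⁿ} − X`);
* §3 `geomReduction_eq_zero_of_mem_rationalLine`, `mem_rationalLine_of_geomReduction_eq_zero` — **the ramified rational
  line is the kernel of reduction on `E[p]`** (an inertia element acts on it by `a ≢ 1`, reduction is inertia-invariant,
  and the kernel has `≤ p` points at an ordinary prime); `geomReduction_pow_smul_of_isArithFrobAt` (`red(σᵏ P) = φᵏ red P`);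
  **`finite_fixedPoints_geomPrimaryTorsion_of_frob`** — under (N1)–(N3), `E[p^∞]^N` is finite: it meets `ker(red)`
  trivially (N1), so `red` is injective on it and `I_{𝔓₀}` acts trivially (N2); then `σⁿ b = τ g b = b` gives
  `red b = φⁿ • red b`, and the `φⁿ`-fixed points are finite (§2).

HONEST FRAMING: helper theorems only (0 definitions, 0 named facts, 0 sorry); no summit statement, no BSD / IMC2 / KY Thm
1.4.1 (iii) is proved; 0 cells / labels move. References: [KellerYin2024] §1.3 Prop. 1.3.3 (iii) (arXiv:2402.12781v2 TeX
L948–957), Lemma 1.3.6; [Serre1972] §1.11 (1), Prop. 11 and proof; [GreenbergLNM1716] §1 p. 62 (Mazur Prop. 6.12), §3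
proof of Lemma 3.3; [Washington1997] §13.1.
-/

set_option autoImplicit false
-- the route's Theorems namespace repeats the summit name by design (D-0017 nested layout)
set_option linter.dupNamespace false

noncomputable section

open scoped Classical Pointwise

namespace Summit.BirchSwinnertonDyer.BirchSwinnertonDyer.Theorems.AnomalousLocalTorsion

open NumberField IsDedekindDomain Field WeierstrassCurve Rat.HeightOneSpectrum Polynomial
  Literature.NumberTheory.EllipticCurves Literature.NumberTheory.EllipticCurves.GreenbergSelmer
  Literature.NumberTheory.EllipticCurves.Rank1Residual Literature.NumberTheory.GaloisRepresentations

/-! ## §1. `ℤ_p`-saturation of closed subgroups and the Frobenius power in `I · (ker κ)` -/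

section ZpExt

variable {K : Type} [Field K] [NumberField K] {p : ℕ} [hp : Fact p.Prime] (κ : ZpExtension K p)

/-- **A closed subgroup of `Γ_K` has `ℤ_p`-saturated image under `κ`**: if `τ₀ ∈ I` then `κ(I) ∋ u · κ(τ₀)` for every
`u ∈ ℤ_p` (`ℕ` is dense in `ℤ_p`, `κ(τ₀^k) = k κ(τ₀)`, and `κ(I)` is compact, hence closed). [cite: Washington1997, §13.1] -/
theorem exists_mem_apply_eq_ofAdd_mul (I : Subgroup (absoluteGaloisGroup K))
    (hI : IsClosed (I : Set (absoluteGaloisGroup K))) {τ₀ : absoluteGaloisGroup K} (hτ₀ : τ₀ ∈ I) (u : ℤ_[p]) :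
    ∃ τ ∈ I, κ τ = Multiplicative.ofAdd (u * (κ τ₀).toAdd) := by
  -- `κ(I)` is closed
  have hIc : IsClosed ((fun g : absoluteGaloisGroup K ↦ κ g) '' (I : Set (absoluteGaloisGroup K))) :=
    (hI.isCompact.image (map_continuous κ)).isClosed
  -- the continuous map `u ↦ ofAdd (u * b)` sends `ℕ` into `κ(I)`
  set f : ℤ_[p] → Multiplicative ℤ_[p] := fun x ↦ Multiplicative.ofAdd (x * (κ τ₀).toAdd) with hf
  have hfc : Continuous f := continuous_ofAdd.comp (continuous_id.mul continuous_const)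
  have hnat : ∀ k : ℕ, f k ∈ (fun g : absoluteGaloisGroup K ↦ κ g) '' (I : Set (absoluteGaloisGroup K)) := by
    intro k
    refine ⟨τ₀ ^ k, I.pow_mem hτ₀ k, ?_⟩
    change κ (τ₀ ^ k) = Multiplicative.ofAdd ((k : ℤ_[p]) * (κ τ₀).toAdd)
    rw [map_pow, ← nsmul_eq_mul, ofAdd_nsmul, ofAdd_toAdd]
  have hpre : IsClosed (f ⁻¹' ((fun g : absoluteGaloisGroup K ↦ κ g) '' (I : Set (absoluteGaloisGroup K)))) :=
    hIc.preimage hfc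
  have hsub : Set.range (Nat.cast : ℕ → ℤ_[p]) ⊆
      f ⁻¹' ((fun g : absoluteGaloisGroup K ↦ κ g) '' (I : Set (absoluteGaloisGroup K))) := by
    rintro _ ⟨k, rfl⟩; exact hnat k
  have huniv : f ⁻¹' ((fun g : absoluteGaloisGroup K ↦ κ g) '' (I : Set (absoluteGaloisGroup K))) = Set.univ := by
    apply Set.eq_univ_of_univ_subset
    rw [← PadicInt.denseRange_natCast.closure_range]
    exact closure_minimal hsub hpre
  have hu : u ∈ f ⁻¹' ((fun g : absoluteGaloisGroup K ↦ κ g) '' (I : Set (absoluteGaloisGroup K))) := by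
    rw [huniv]; exact Set.mem_univ u
  obtain ⟨τ, hτI, hτ⟩ := hu
  exact ⟨τ, hτI, hτ⟩

/-- **The Frobenius power in `I · Gal(K̄/K_∞)`.** For a `ℤ_p`-extension `κ`, a CLOSED subgroup `I ≤ Γ_K` containing some
`τ₀` with `κ τ₀ ≠ 1` (e.g. `I = I_v̄` on the anticyclotomic tower, `exists_mem_inertia_apply_ne_one_of_isAnticyclotomic`) and
ANY `σ ∈ Γ_K`: `σ^{pᵐ} · τ ∈ ker κ` for some `m` and some `τ ∈ I`. (With `b = κ τ₀ = u_b pᵐ`: `κ(I) ⊇ ℤ_p b = pᵐ ℤ_p ∋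
−pᵐ κ σ`.) [cite: Washington1997, §13.1] -/
theorem exists_pow_mul_mem_kerSubgroup (I : Subgroup (absoluteGaloisGroup K))
    (hI : IsClosed (I : Set (absoluteGaloisGroup K))) {τ₀ : absoluteGaloisGroup K} (hτ₀ : τ₀ ∈ I) (hne : κ τ₀ ≠ 1)
    (σ : absoluteGaloisGroup K) : ∃ m : ℕ, ∃ τ ∈ I, σ ^ p ^ m * τ ∈ κ.kerSubgroup := by
  set b : ℤ_[p] := (κ τ₀).toAdd with hb
  have hb0 : b ≠ 0 := fun h ↦ hne (by rw [← ofAdd_toAdd (κ τ₀), ← hb, h]; rfl)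
  set a : ℤ_[p] := (κ σ).toAdd with ha
  set m : ℕ := b.valuation with hm
  -- `b = u_b * p^m`
  have hbu : b = (PadicInt.unitCoeff hb0 : ℤ_[p]) * (p : ℤ_[p]) ^ m := PadicInt.unitCoeff_spec hb0
  set u : ℤ_[p] := -(a * ((PadicInt.unitCoeff hb0)⁻¹ : ℤ_[p]ˣ)) with hu
  have hub : u * b = -((p : ℤ_[p]) ^ m * a) := by
    have h1 : u * b = -(a * (((PadicInt.unitCoeff hb0)⁻¹ : ℤ_[p]ˣ) : ℤ_[p])) *
        ((PadicInt.unitCoeff hb0 : ℤ_[p]) * (p : ℤ_[p]) ^ m) := by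
      rw [← hbu]
    rw [h1, neg_mul, mul_assoc, ← mul_assoc (((PadicInt.unitCoeff hb0)⁻¹ : ℤ_[p]ˣ) : ℤ_[p]),
      Units.inv_mul, one_mul, mul_comm a]
  obtain ⟨τ, hτI, hτ⟩ := exists_mem_apply_eq_ofAdd_mul κ I hI hτ₀ u
  refine ⟨m, τ, hτI, ?_⟩
  rw [ZpExtension.mem_kerSubgroup, map_mul, map_pow, hτ, ← hb, hub]
  apply Multiplicative.toAdd.injective
  rw [toAdd_mul, toAdd_pow, toAdd_ofAdd, toAdd_one, ← ha, nsmul_eq_mul, Nat.cast_pow, add_neg_cancel]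

end ZpExt

/-! ## §2. Frobenius powers on `Ẽ(𝔽̄_p)` have finitely many fixed points -/

section Frob

variable {p : ℕ} [hp : Fact p.Prime] (W' : WeierstrassCurve (ZMod p))

/-- `φᵏ • x = x^{pᵏ}` for the `p`-power Frobenius `φ` of `𝔽̄_p`. [folklore] -/
theorem frob_pow_smul_eq {φ : absoluteGaloisGroup (ZMod p)} (hφ : ∀ x : AlgebraicClosure (ZMod p), φ • x = x ^ p)
    (k : ℕ) (x : AlgebraicClosure (ZMod p)) : φ ^ k • x = x ^ p ^ k := by
  induction k with
  | zero => rw [pow_zero, one_smul, pow_zero, pow_one]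
  | succ k ih => rw [pow_succ', mul_smul, ih, hφ, ← pow_mul, ← pow_succ]

/-- **The `φⁿ`-fixed points of `Ẽ(𝔽̄_p)` form a finite set** (`n ≠ 0`): a fixed affine point has both coordinates in the
root set of `X^{pⁿ} − X`. («An abelian variety has only finitely many points over a finite field», KY TeX L955.)
[cite: KellerYin2024, §1.3 proof of Prop. 1.3.3 (iii) (arXiv:2402.12781v2 TeX L948–957)] -/
theorem finite_setOf_frob_pow_smul_eq {φ : absoluteGaloisGroup (ZMod p)}
    (hφ : ∀ x : AlgebraicClosure (ZMod p), φ • x = x ^ p) {n : ℕ} (hn : n ≠ 0) :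
    Set.Finite {Q : W'.geomPoints | φ ^ n • Q = Q} := by
  have hpr : p.Prime := hp.out
  set L := AlgebraicClosure (ZMod p)
  -- the finite set of roots of `X^{p^n} - X`
  set f : (ZMod p)[X] := X ^ p ^ n - X with hfdef
  have hf0 : f ≠ 0 := FiniteField.X_pow_card_pow_sub_X_ne_zero (ZMod p) hn hpr.one_lt
  set S : Set L := f.rootSet L with hS
  have hSfin : S.Finite := Polynomial.rootSet_finite f L
  have hmemS : ∀ x : L, x ^ p ^ n = x → x ∈ S := fun x hx ↦ by
    rw [hS, Polynomial.mem_rootSet]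
    refine ⟨hf0, ?_⟩
    rw [hfdef, map_sub, map_pow, Polynomial.aeval_X, hx, sub_self]
  -- coordinates of a point
  let pt : W'.geomPoints → Option (L × L) := fun Q ↦ match Q with
    | .zero => none
    | .some x y _ => some (x, y)
  have hpt : Function.Injective pt := by
    intro Q₁ Q₂ h
    rcases Q₁ with _ | ⟨x₁, y₁, h₁⟩ <;> rcases Q₂ with _ | ⟨x₂, y₂, h₂⟩
    · rfl
    · exact absurd h (by simp [pt])
    · exact absurd h (by simp [pt])
    · simp only [pt, Option.some.injEq, Prod.mk.injEq] at h
      obtain ⟨rfl, rfl⟩ := h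
      rfl
  have hTfin : (insert none ((fun xy : L × L ↦ some xy) '' (S ×ˢ S))).Finite :=
    ((hSfin.prod hSfin).image _).insert none
  refine (hTfin.preimage hpt.injOn).subset fun Q hQ ↦ ?_
  change φ ^ n • Q = Q at hQ
  rcases Q with _ | ⟨x, y, hxy⟩
  · exact Set.mem_insert _ _
  · refine Set.mem_insert_of_mem _ ⟨(x, y), ⟨hmemS x ?_, hmemS y ?_⟩, rfl⟩ <;>
    · have hψinj : Function.Injective ((absoluteGaloisGroup.toAlgEquiv (ZMod p) (φ ^ n)).toAlgHom :
          L →ₐ[ZMod p] L) := (absoluteGaloisGroup.toAlgEquiv (ZMod p) (φ ^ n)).injective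
      have hns : (W'.baseChange L).toAffine.Nonsingular (φ ^ n • x) (φ ^ n • y) :=
        (Affine.baseChange_nonsingular (W := W'.toAffine) hψinj x y).mpr hxy
      have h' : (Affine.Point.some (φ ^ n • x) (φ ^ n • y) hns : W'.geomPoints) = Affine.Point.some x y hxy := hQ
      simp only [Affine.Point.some.injEq] at h'
      first
        | (rw [← frob_pow_smul_eq hφ n x]; exact h'.1)
        | (rw [← frob_pow_smul_eq hφ n y]; exact h'.2)

end Frob

/-! ## §3. The `ℚ`-side core: `E[p^∞]^N` is finite -/

section Core

variable {W : WeierstrassCurve ℚ} [W.IsElliptic] [W.IsGloballyMinimal] {p : ℕ} [hp : Fact p.Prime]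

/-- `red(σᵏ • P) = φᵏ • red P` for an arithmetic Frobenius `σ` at the place's prime. [cite: Serre1972, §1.11 Prop. 11 (proof)] -/
theorem geomReduction_pow_smul_of_isArithFrobAt (hΔ : ¬ (p : ℤ) ∣ minimalDiscriminantInt W)
    {𝔓 : Ideal (absIntegers (𝓞 ℚ) ℚ)}
    (hmem : ∀ x : absIntegers (𝓞 ℚ) ℚ, x ∈ 𝔓 ↔ (x : AlgebraicClosure ℚ) ∈ (placeOver p).nonunits)
    {v : HeightOneSpectrum (𝓞 ℚ)} (hv : (primesEquiv v : ℕ) = p) (h𝔓 : 𝔓 ∈ v.primesAbove)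
    {σ : absoluteGaloisGroup ℚ} (hσ : IsArithFrobAt (𝓞 ℚ) σ 𝔓)
    {φ : absoluteGaloisGroup (ZMod p)} (hφ : ∀ x : AlgebraicClosure (ZMod p), φ • x = x ^ p)
    (k : ℕ) (P : W.geomPoints) :
    geomReduction hΔ (σ ^ k • P) = φ ^ k • geomReduction hΔ P := by
  induction k with
  | zero => rw [pow_zero, pow_zero, one_smul, one_smul]
  | succ k ih => rw [pow_succ', mul_smul, geomReduction_smul_of_isArithFrobAt hΔ hmem hv h𝔓 hσ hφ, ih, pow_succ',
      mul_smul]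

/-- **The ramified rational line reduces to `Õ`**: if the rational `p`-line `Φ₀` is NOT unramified at `p` then
`red P = 0` for every `P ∈ Φ₀` (some `σ ∈ I_{𝔓₀}` acts on `Φ₀` by `a ≢ 1 (mod p)` while `red ∘ σ = red`).
[cite: Serre1972, §1.11 (1), Prop. 11 and Cor.] -/
theorem geomReduction_eq_zero_of_mem_rationalLine (hΔ : ¬ (p : ℤ) ∣ minimalDiscriminantInt W)
    {𝔓 : Ideal (absIntegers (𝓞 ℚ) ℚ)}
    (hmem : ∀ x : absIntegers (𝓞 ℚ) ℚ, x ∈ 𝔓 ↔ (x : AlgebraicClosure ℚ) ∈ (placeOver p).nonunits)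
    {v : HeightOneSpectrum (𝓞 ℚ)} (hu : (p : 𝓞 ℚ) ∈ v.asIdeal) (h𝔓 : 𝔓 ∈ v.primesAbove)
    {Φ₀ : AddSubgroup (geomTorsion W (p : ℤ))} (hΦ₀ : IsRationalLine W p Φ₀) (hram : ¬ LineUnramifiedAt W p Φ₀)
    {P : geomTorsion W (p : ℤ)} (hP : P ∈ Φ₀) : geomReduction hΔ (P : W.geomPoints) = 0 := by
  have hpr : p.Prime := hp.out
  obtain ⟨σ, hσ, P₁, hP₁, hne⟩ := exists_mem_inertia_smul_ne_of_not_lineUnramifiedAt hΦ₀ hram hu h𝔓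
  have hP₁0 : P₁ ≠ 0 := fun h ↦ hne (by rw [h, smul_zero])
  -- `σ` acts on the generator `P₁` of `Φ₀` by an integer `a`
  obtain ⟨hpP₁, hgen⟩ := exists_zsmul_eq_of_natCard_eq (p := p) Φ₀ hΦ₀.1 hP₁ hP₁0
  obtain ⟨a, ha⟩ := hgen _ (hΦ₀.2 σ P₁ hP₁)
  -- `(a - 1) • red P₁ = 0` and `p • red P₁ = 0`
  have hp1 : (p : ℤ) • (P₁ : W.geomPoints) = 0 := (Submodule.mem_torsionBy_iff _ _).mp P₁.2
  have hredσ : geomReduction hΔ (σ • (P₁ : W.geomPoints)) = geomReduction hΔ (P₁ : W.geomPoints) :=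
    geomReduction_smul_of_mem_inertia hΔ hmem hσ _
  have ha1 : (a - 1) • geomReduction hΔ (P₁ : W.geomPoints) = 0 := by
    rw [sub_smul, one_smul, ← map_zsmul, sub_eq_zero]
    have h := congrArg (fun Q : geomTorsion W (p : ℤ) ↦ geomReduction hΔ (Q : W.geomPoints)) ha
    simp only [AddSubgroup.torsionBy.coe_smul] at h
    rw [h, hredσ]
  -- `p ∤ a - 1` (else `σ • P₁ = P₁`)
  have hndvd : ¬ (p : ℤ) ∣ a - 1 := by
    rintro ⟨c, hc⟩
    apply hne
    rw [← ha, show a = 1 + p * c by linear_combination hc, add_smul, one_smul, mul_comm, ← smul_smul]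
    have : (p : ℤ) • P₁ = 0 := by rw [← natCast_zsmul] at hpP₁; exact_mod_cast hpP₁
    rw [this, smul_zero, add_zero]
  have hpred : (p : ℤ) • geomReduction hΔ (P₁ : W.geomPoints) = 0 := by rw [← map_zsmul, hp1, map_zero]
  have hirr : Irreducible (p : ℤ) := (Nat.prime_iff_prime_int.mp hpr).irreducible
  obtain ⟨x, y, hxy⟩ := hirr.coprime_iff_not_dvd.mpr hndvd
  have hredP₁ : geomReduction hΔ (P₁ : W.geomPoints) = 0 := by
    calc geomReduction hΔ (P₁ : W.geomPoints)
        = (x * p + y * (a - 1)) • geomReduction hΔ (P₁ : W.geomPoints) := by rw [hxy, one_smul]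
      _ = 0 := by rw [add_smul, mul_smul, mul_smul, hpred, ha1, smul_zero, smul_zero, add_zero]
  -- `P` is a multiple of `P₁`
  obtain ⟨k, rfl⟩ := hgen P hP
  rw [AddSubgroupClass.coe_zsmul, map_zsmul, hredP₁, smul_zero]

/-- **The kernel of reduction on `E[p]` is the ramified rational line** at an ordinary prime: `red P = 0`, `P ∈ E[p]`
implies `P ∈ Φ₀` (the kernel has at most `p` points, `card_ker_le_of_exists_ne_zero`, and contains the line).
[cite: Serre1972, §1.11 (1) («le noyau `X_p` est cyclique d'ordre `p`»)] -/
theorem mem_rationalLine_of_geomReduction_eq_zero (hΔ : ¬ (p : ℤ) ∣ minimalDiscriminantInt W)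
    (hord : ¬ (p : ℤ) ∣ W.frobeniusTrace p) {𝔓 : Ideal (absIntegers (𝓞 ℚ) ℚ)}
    (hmem : ∀ x : absIntegers (𝓞 ℚ) ℚ, x ∈ 𝔓 ↔ (x : AlgebraicClosure ℚ) ∈ (placeOver p).nonunits)
    {v : HeightOneSpectrum (𝓞 ℚ)} (hu : (p : 𝓞 ℚ) ∈ v.asIdeal) (h𝔓 : 𝔓 ∈ v.primesAbove)
    {Φ₀ : AddSubgroup (geomTorsion W (p : ℤ))} (hΦ₀ : IsRationalLine W p Φ₀) (hram : ¬ LineUnramifiedAt W p Φ₀)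
    {P : geomTorsion W (p : ℤ)} (hP : geomReduction hΔ (P : W.geomPoints) = 0) : P ∈ Φ₀ := by
  have hpr : p.Prime := hp.out
  set f : geomTorsion W (p : ℤ) →+ (reductionModPrime W p).geomPoints :=
    (geomReduction hΔ).comp (geomTorsion W (p : ℤ)).subtype with hf
  have hp0 : (p : AlgebraicClosure ℚ) ≠ 0 := Nat.cast_ne_zero.mpr hpr.ne_zero
  have hcard : Nat.card (geomTorsion W (p : ℤ)) = p ^ 2 := card_torsionPoints_eq_sq_holds W (AlgebraicClosure ℚ) (n := p) hp0
  haveI : Finite (geomTorsion W (p : ℤ)) := Nat.finite_of_card_ne_zero (by rw [hcard]; exact pow_ne_zero _ hpr.ne_zero)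
  have hf0 : ∃ x : geomTorsion W (p : ℤ), f x ≠ 0 := by
    obtain ⟨Q, hQ, hredQ⟩ := exists_zsmul_eq_zero_geomReduction_ne_zero p hΔ hord
    exact ⟨⟨Q, (Submodule.mem_torsionBy_iff _ _).mpr hQ⟩, hredQ⟩
  letI : Module (ZMod p) (geomTorsion W (p : ℤ)) := AddSubgroup.torsionBy.zmodModule
  have hle : Nat.card f.ker ≤ p := card_ker_le_of_exists_ne_zero hcard f hf0
  have hΦle : Φ₀ ≤ f.ker := fun Q hQ ↦ by
    rw [AddMonoidHom.mem_ker]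
    exact geomReduction_eq_zero_of_mem_rationalLine hΔ hmem hu h𝔓 hΦ₀ hram hQ
  have heq : Φ₀ = f.ker := AddSubgroup.eq_of_le_of_card_ge hΦle (hle.trans hΦ₀.1.ge)
  rw [heq, AddMonoidHom.mem_ker]
  exact hP

/-- **Fin_v, `ℚ`-side core.** `E = W/ℚ` globally minimal, `p ∤ Δ_W` (good), `p ∤ a_p` (ordinary), `𝔓₀` the prime of
`\bar ℤ` cut out by the place, `Φ₀` the rational `p`-line, NOT unramified at `p`, and `N ≤ Γ_ℚ` with: (N1) some `g ∈ N`
moves `Φ₀`; (N2) `B = E[p^∞]^N` is stable under `I_{𝔓₀}`; (N3) `σⁿ τ ∈ N` for an arithmetic Frobenius `σ` at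
`𝔓₀`, `n ≠ 0`, `τ ∈ I_{𝔓₀}`. THEN `B` IS FINITE: `B ∩ ker(red) = 0` ((N1) + the kernel of reduction on `E[p]` is `Φ₀`),
so `red` is injective on `B` and `I_{𝔓₀}` acts trivially on `B` ((N2), `red ∘ τ = red`); hence `σⁿ` acts trivially on `B`
and `red B ⊆ Ẽ(𝔽̄_p)^{φⁿ}`, a finite set ((N3)). (KY Prop. 1.3.3 (iii) via Galois modules instead of Néron models.)
[cite: KellerYin2024, §1.3 Prop. 1.3.3 (iii) (arXiv:2402.12781v2 TeX L948–957)] [cite: GreenbergLNM1716, §1 p. 62, §3 p. 86]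
[cite: Serre1972, §1.11 Prop. 11] -/
theorem finite_fixedPoints_geomPrimaryTorsion_of_frob (hΔ : ¬ (p : ℤ) ∣ minimalDiscriminantInt W)
    (hord : ¬ (p : ℤ) ∣ W.frobeniusTrace p) {𝔓 : Ideal (absIntegers (𝓞 ℚ) ℚ)}
    (hmem : ∀ x : absIntegers (𝓞 ℚ) ℚ, x ∈ 𝔓 ↔ (x : AlgebraicClosure ℚ) ∈ (placeOver p).nonunits)
    {v : HeightOneSpectrum (𝓞 ℚ)} (hv : (primesEquiv v : ℕ) = p) (hu : (p : 𝓞 ℚ) ∈ v.asIdeal)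
    (h𝔓 : 𝔓 ∈ v.primesAbove)
    {Φ₀ : AddSubgroup (geomTorsion W (p : ℤ))} (hΦ₀ : IsRationalLine W p Φ₀) (hram : ¬ LineUnramifiedAt W p Φ₀)
    (N : Subgroup (absoluteGaloisGroup ℚ))
    (hN1 : ∃ g ∈ N, ∃ P ∈ Φ₀, g • P ≠ P)
    (hN2 : ∀ τ ∈ 𝔓.inertia (absoluteGaloisGroup ℚ), ∀ b ∈ FixedPoints.addSubgroup N (geomPrimaryTorsion W p),
      τ • b ∈ FixedPoints.addSubgroup N (geomPrimaryTorsion W p))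
    (hN3 : ∃ σ : absoluteGaloisGroup ℚ, IsArithFrobAt (𝓞 ℚ) σ 𝔓 ∧ ∃ n : ℕ, n ≠ 0 ∧
      ∃ τ ∈ 𝔓.inertia (absoluteGaloisGroup ℚ), σ ^ n * τ ∈ N) :
    (FixedPoints.addSubgroup N (geomPrimaryTorsion W p) : Set (geomPrimaryTorsion W p)).Finite := by
  have hpr : p.Prime := hp.out
  set B := FixedPoints.addSubgroup N (geomPrimaryTorsion W p) with hB
  set red := geomReduction (p := p) (W := W) hΔ with hred
  have hmemB : ∀ {b : geomPrimaryTorsion W p}, b ∈ B ↔ ∀ g ∈ N, g • b = b := fun {b} ↦ by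
    rw [hB, FixedPoints.mem_addSubgroup]
    exact ⟨fun h g hg ↦ h ⟨g, hg⟩, fun h g ↦ h g.1 g.2⟩
  -- (1) `B ∩ Φ₀ = 0`: an `N`-fixed point of `E[p]` with `red = 0` vanishes
  have h1 : ∀ b ∈ B, p • b = 0 → red ((b : geomPrimaryTorsion W p) : W.geomPoints) = 0 → b = 0 := by
    intro b hb hpb hredb
    by_contra hb0
    have hbp : (p : ℤ) • ((b : geomPrimaryTorsion W p) : W.geomPoints) = 0 := by
      rw [natCast_zsmul, ← AddSubmonoidClass.coe_nsmul, hpb, ZeroMemClass.coe_zero]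
    set P : geomTorsion W (p : ℤ) := ⟨(b : W.geomPoints), (Submodule.mem_torsionBy_iff _ _).mpr hbp⟩ with hPdef
    have hPΦ : P ∈ Φ₀ := mem_rationalLine_of_geomReduction_eq_zero hΔ hord hmem hu h𝔓 hΦ₀ hram hredb
    have hP0 : P ≠ 0 := fun h ↦ hb0 (Subtype.ext (by
      have h' := congrArg (fun Q : geomTorsion W (p : ℤ) ↦ (Q : W.geomPoints)) h
      simpa only [hPdef, ZeroMemClass.coe_zero] using h'))
    obtain ⟨-, hgen⟩ := exists_zsmul_eq_of_natCard_eq (p := p) Φ₀ hΦ₀.1 hPΦ hP0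
    obtain ⟨g, hg, Q, hQ, hgQ⟩ := hN1
    obtain ⟨k, rfl⟩ := hgen Q hQ
    apply hgQ
    have hgb : g • ((b : geomPrimaryTorsion W p) : W.geomPoints) = (b : W.geomPoints) := by
      rw [← primaryComponent.coe_smul, hmemB.mp hb g hg]
    have hgP : g • P = P := Subtype.ext (by rw [AddSubgroup.torsionBy.coe_smul]; exact hgb)
    rw [smul_comm g k P, hgP]
  -- (2) `B ∩ ker(red) = 0`
  have h2 : ∀ b ∈ B, red ((b : geomPrimaryTorsion W p) : W.geomPoints) = 0 → b = 0 := by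
    intro b hb hredb
    by_contra hb0
    obtain ⟨j, hne, hpj⟩ := W.exists_pow_smul_ne_zero_and_p_smul_eq_zero hb0
    refine hne (h1 _ (B.nsmul_mem hb _) hpj ?_)
    rw [AddSubmonoidClass.coe_nsmul, map_nsmul, hredb, smul_zero]
  -- (3) `red` is injective on `B`
  have h3 : ∀ b₁ ∈ B, ∀ b₂ ∈ B, red ((b₁ : geomPrimaryTorsion W p) : W.geomPoints) =
      red ((b₂ : geomPrimaryTorsion W p) : W.geomPoints) → b₁ = b₂ := by
    intro b₁ hb₁ b₂ hb₂ h
    have h' := h2 (b₁ - b₂) (B.sub_mem hb₁ hb₂) (by rw [AddSubgroupClass.coe_sub, map_sub, h, sub_self])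
    exact sub_eq_zero.mp h'
  -- (4) inertia acts trivially on `B`
  have h4 : ∀ τ ∈ 𝔓.inertia (absoluteGaloisGroup ℚ), ∀ b ∈ B, τ • b = b := by
    intro τ hτ b hb
    refine h3 _ (hN2 τ hτ b hb) _ hb ?_
    rw [primaryComponent.coe_smul, geomReduction_smul_of_mem_inertia hΔ hmem hτ]
  -- (5) `σⁿ` acts trivially on `B`, so `red b` is `φⁿ`-fixed
  obtain ⟨σ, hσ, n, hn, τ, hτ, hσn⟩ := hN3
  obtain ⟨φ, hφ'⟩ := exists_frobenius_absoluteGaloisGroup (ZMod p)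
  have hφ : ∀ x : AlgebraicClosure (ZMod p), φ • x = x ^ p := fun x ↦ by rw [hφ' x, Nat.card_zmod]
  have h5 : ∀ b ∈ B, φ ^ n • red ((b : geomPrimaryTorsion W p) : W.geomPoints) =
      red ((b : geomPrimaryTorsion W p) : W.geomPoints) := by
    intro b hb
    have hσb : σ ^ n • b = b := by
      have h := hmemB.mp hb _ hσn
      rwa [mul_smul, h4 τ hτ b hb] at h
    rw [← geomReduction_pow_smul_of_isArithFrobAt hΔ hmem hv h𝔓 hσ hφ n, ← primaryComponent.coe_smul, hσb]
  -- (6) finiteness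
  have hfin := finite_setOf_frob_pow_smul_eq (reductionModPrime W p) hφ hn
  haveI : Finite {Q : (reductionModPrime W p).geomPoints | φ ^ n • Q = Q} := hfin.to_subtype
  have hinj : Function.Injective (fun b : B ↦ (⟨red ((b : geomPrimaryTorsion W p) : W.geomPoints), h5 _ b.2⟩ :
      {Q : (reductionModPrime W p).geomPoints | φ ^ n • Q = Q})) := by
    intro b₁ b₂ h
    exact Subtype.ext (h3 _ b₁.2 _ b₂.2 (congrArg Subtype.val h))
  haveI : Finite B := Finite.of_injective _ hinj
  exact Set.toFinite _

end Core

end Summit.BirchSwinnertonDyer.BirchSwinnertonDyer.Theorems.AnomalousLocalTorsion
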